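import Mathlib
import Literature.AlgebraicGeometry.Motives.FrobeniusTraceProofs
import Summits.ValiantsHypothesis.ValiantsHypothesis.Theorems.LacunarySymmetroidMatrixDescartesRolleSchurStep

/-!
# Crux `MatrixDescartes` (stmt-ValiantsHypothesis-18050), line `rolle-schur-residual` —
# STUB `stub_forcedZeros` (instrument lemma K3 «forced zeros»), PROVED

Line file: `Summits/ValiantsHypothesis/ValiantsHypothesis/Cruxes/MatrixDescartes/Lines/rolle_schur_residual.lean`
(ideator val-idea-3; stub typed at critic-1's request), stub K3 (support, M; an INSTRUMENT lemma,
not in the cone of the line's `MatrixDescartes_of`).  The statement `forcedZeros` below is the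
line's stub with its local vocabulary (`pencil`, `shifted`, `adjVec`, `residual`) UNFOLDED to
Mathlib terms (the line file lives under `Cruxes/` and carries `sorry`s, so it cannot be
imported); the two statements agree definitionally, so the line closes its stub by
`exact RolleSchur.forcedZeros` (checked against a verbatim copy of the line's definitions).

**Statement.**  `F = ∑ₗ X^{dₗ} Sₗ` with real symmetric `m × m` letters, `f = det F`,
`0 < x₁ < x₂` two SIMPLE roots of `f` (`F(xᵢ) kᵢ = 0`, `kᵢ ≠ 0`, `f′(xᵢ) ≠ 0`) whose crossings
have opposite directions, `(k₁ᵀF′(x₁)k₁)·(k₂ᵀF′(x₂)k₂) < 0` (a walk reversal), `w` with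
`w·k₁ ≠ 0 ≠ w·k₂`, `e` real.  Then the residual `P_{w,e} = uᵀ M_e u` (`u = adj(F) w`,
`M_e = ∑ₗ (dₗ − e) X^{dₗ} Sₗ`) vanishes somewhere in `(x₁, x₂)`.  Consequence for the line:
`rev(F) ≤ Z₊(P_{w,e})` (walk reversals force zeros of the residual).

**Proof (not the card's resolvent-monotonicity route; a two-point sign computation).**
§2 HELLMANN–FEYNMAN IDENTITY at a simple root `x₀` with kernel vector `k`:
`a(x₀) · kᵀF′(x₀)k = f′(x₀) · (w·k)²`, `a = wᵀ adj(F) w` (`compDet_mul_quadForm_eq`).  Ingredients: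
Jacobi's formula `f′ = tr(adj F · F′)` (tree lemma
`Literature.AlgebraicGeometry.Motives.FrobeniusTrace.derivation_det_eq_trace` for the derivation
`d/dX`, evaluated: `eval_derivative_det`); §1: a matrix killing two independent vectors has zero
adjugate (`adjugate_eq_zero_of_two_kernel`, cofactor = determinant with a row replaced by a basis
vector), hence at a simple root `ker F(x₀) = ℝk` (`exists_eq_smul_of_kernel`); `F·adj F = 0` at
`x₀` gives `adj F(x₀) w = β k`; differentiating `F·adj F = f•1` (`RolleSchur.map_derivative_mul`,
landed) and evaluating gives `adj F(x₀)·F′(x₀)·k = f′(x₀) k`, so `β·kᵀF′k = f′(x₀)(w·k)`.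
§3: at a root, `P(x₀) = x₀ f′(x₀) a(x₀)` (`eval_residual_of_root`, from the landed residual
identity `P = X(f′a − fa′) − e·fa`); therefore
`P(x₁)P(x₂)·(k₁ᵀF′k₁)(k₂ᵀF′k₂) = x₁x₂ (f′(x₁)(w·k₁))² (f′(x₂)(w·k₂))² > 0`, so `P(x₁)P(x₂) < 0`
and the intermediate value theorem gives the zero.  The stub's hypothesis «no root of `f` in
`(x₁, x₂)`» is carried but not used.  Elementary; Mathlib + the tree's Jacobi lemma; axioms
`propext`, `Classical.choice`, `Quot.sound`.

Honest framing: an M-sized INSTRUMENT stub of a registered line of the V1 crux (it makes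
`min_{w,e} Z₊(P_{w,e}) ≥ rev F` a kernel instrument); instrument/structure tier.  The line's law
(`stub_residualLaw`, XL) is untouched and is now the line's only open stub; the crux
`LacunarySymmetroid.MatrixDescartes`, Conjecture B (`KPlusLogSqLaw`) and rung V1 do NOT move;
`VP ≠ VNP` is NOT proved and nothing here is progress on it.  No definitions, no named facts.
-/

-- `Summit.ValiantsHypothesis.ValiantsHypothesis.…` is the tree's mandated single-conjunct layout
-- (Sub = Summit), so the duplicated namespace component is intended.
set_option linter.dupNamespace false
set_option autoImplicit false

namespace Summit.ValiantsHypothesis.ValiantsHypothesis.Theorems.LacunarySymmetroidMatrixDescartes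

open Polynomial Matrix Finset
open scoped BigOperators

namespace RolleSchur

/-! ## §1 The adjugate at a kernel of dimension ≥ 2, and the kernel line at a simple root -/

/-- If a square matrix over `ℝ` kills two linearly independent vectors, its adjugate vanishes:
every cofactor is the determinant of `A` with one row replaced by a basis vector, and that matrix
still has a nonzero kernel vector. [folklore] -/
theorem adjugate_eq_zero_of_two_kernel {n : Type*} [Fintype n] [DecidableEq n]
    (A : Matrix n n ℝ) (v k : n → ℝ) (hv : A *ᵥ v = 0) (hk : A *ᵥ k = 0)
    (hind : ∀ a b : ℝ, a • v + b • k = 0 → a = 0 ∧ b = 0) : A.adjugate = 0 := by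
  ext i j
  rw [Matrix.adjugate_apply, Matrix.zero_apply]
  -- a nonzero kernel vector `u` of `A` with `u i = 0`
  obtain ⟨u, hu0, hAu, hui⟩ : ∃ u : n → ℝ, u ≠ 0 ∧ A *ᵥ u = 0 ∧ u i = 0 := by
    by_cases hvi : v i = 0
    · refine ⟨v, fun h => ?_, hv, hvi⟩
      have h1 := hind 1 0 (by rw [h, smul_zero, zero_smul, add_zero])
      exact one_ne_zero h1.1
    · refine ⟨k i • v - v i • k, fun h => ?_, ?_, ?_⟩
      · have h' : k i • v + (-(v i)) • k = 0 := by
          rw [neg_smul, ← sub_eq_add_neg]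
          exact h
        exact hvi (neg_eq_zero.mp (hind _ _ h').2)
      · rw [Matrix.mulVec_sub, Matrix.mulVec_smul, Matrix.mulVec_smul, hv, hk, smul_zero, smul_zero,
          sub_zero]
      · simp [mul_comm]
  refine Matrix.exists_mulVec_eq_zero_iff.mp ⟨u, hu0, ?_⟩
  funext l
  by_cases hl : l = j
  · subst hl
    simp [Matrix.mulVec, Matrix.updateRow_self, hui]
  · have h := congrFun hAu l
    simp only [Matrix.mulVec, Pi.zero_apply] at h ⊢
    rw [Matrix.updateRow_ne hl]
    exact h

/-- If `A k = 0`, `k ≠ 0` and `adj A ≠ 0`, the kernel of `A` is the line through `k`. [folklore] -/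
theorem exists_eq_smul_of_kernel {n : Type*} [Fintype n] [DecidableEq n]
    (A : Matrix n n ℝ) (v k : n → ℝ) (hv : A *ᵥ v = 0) (hk : A *ᵥ k = 0) (hk0 : k ≠ 0)
    (hadj : A.adjugate ≠ 0) : ∃ t : ℝ, v = t • k := by
  by_contra hne
  push Not at hne
  apply hadj
  refine adjugate_eq_zero_of_two_kernel A v k hv hk fun a b hab => ?_
  by_cases ha : a = 0
  · subst ha
    rw [zero_smul, zero_add] at hab
    exact ⟨rfl, (smul_eq_zero.mp hab).resolve_right hk0⟩
  · exfalso
    have hav : a • v = -(b • k) := eq_neg_of_add_eq_zero_left hab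
    apply hne (-(a⁻¹ * b))
    calc v = a⁻¹ • (a • v) := by rw [smul_smul, inv_mul_cancel₀ ha, one_smul]
      _ = -(a⁻¹ * b) • k := by rw [hav, smul_neg, smul_smul, neg_smul]

/-! ## §2 Jacobi's formula at a point and the Hellmann–Feynman identity -/

/-- Evaluation commutes with the adjugate. [folklore] -/
theorem adjugate_map_eval {n : Type*} [Fintype n] [DecidableEq n] (F : Matrix n n ℝ[X]) (x₀ : ℝ) :
    F.adjugate.map (Polynomial.eval x₀) = (F.map (Polynomial.eval x₀)).adjugate := by
  have h := RingHom.map_adjugate (Polynomial.evalRingHom x₀) F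
  rwa [RingHom.mapMatrix_apply, RingHom.mapMatrix_apply, Polynomial.coe_evalRingHom] at h

/-- **Jacobi's formula at a point**: `(det F)′(x₀) = tr(adj F(x₀) · F′(x₀))` (tree lemma
`Literature.….FrobeniusTrace.derivation_det_eq_trace` for the derivation `d/dX`, evaluated).
[folklore] -/
theorem eval_derivative_det {n : Type*} [Fintype n] [DecidableEq n] (F : Matrix n n ℝ[X])
    (x₀ : ℝ) :
    (derivative F.det).eval x₀ =
      ((F.map (Polynomial.eval x₀)).adjugate *
        F.map (fun p => (derivative p).eval x₀)).trace := by
  have hJ := Literature.AlgebraicGeometry.Motives.FrobeniusTrace.derivation_det_eq_trace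
    (Polynomial.derivative' : Derivation ℝ ℝ[X] ℝ[X]) F
  rw [Polynomial.derivative'_apply] at hJ
  have hF' : F.map (⇑(Polynomial.derivative' : Derivation ℝ ℝ[X] ℝ[X])) = F.map (⇑derivative) := by
    refine Matrix.ext fun i j => ?_
    simp only [Matrix.map_apply, Polynomial.derivative'_apply]
  rw [hF'] at hJ
  have hD : F.map (fun p => (derivative p).eval x₀) =
      (F.map (⇑derivative)).map (Polynomial.eval x₀) := by
    rw [Matrix.map_map]
    rfl
  rw [hJ, hD, ← adjugate_map_eval, ← Polynomial.coe_evalRingHom, ← Matrix.map_mul,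
    AddMonoidHom.map_trace]

/-- For a symmetric matrix: `(A v) · x = v · (A x)` (real version). [folklore] -/
theorem mulVec_dotProduct_of_isSymm_real {n : Type*} [Fintype n] {A : Matrix n n ℝ}
    (hA : A.IsSymm) (v x : n → ℝ) : (A *ᵥ v) ⬝ᵥ x = v ⬝ᵥ (A *ᵥ x) := by
  rw [Matrix.dotProduct_mulVec, ← Matrix.vecMul_transpose, hA.eq]

/-- **Hellmann–Feynman identity at a simple root.**  Let `F` be a symmetric square matrix over
`ℝ[X]`, `f = det F`, `x₀` real with `F(x₀) k = 0`, `k ≠ 0`, `f′(x₀) ≠ 0`.  Then for every real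
`w`: `(wᵀ adj F(x₀) w) · (kᵀ F′(x₀) k) = f′(x₀) · (w·k)²`.  (At a simple root the kernel is the
line `ℝk` — otherwise `adj F(x₀) = 0` and Jacobi gives `f′(x₀) = 0` —, `adj F(x₀) w = β k` since
`F · adj F = 0` at `x₀`, and `adj F(x₀) F′(x₀) k = f′(x₀) k` from differentiating `adj F · F = f•1`.)
[folklore] -/
theorem compDet_mul_quadForm_eq {n : Type*} [Fintype n] [DecidableEq n] (F : Matrix n n ℝ[X])
    (hF : F.IsSymm) (x₀ : ℝ) (k w : n → ℝ) (hk : (F.map (Polynomial.eval x₀)) *ᵥ k = 0)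
    (hk0 : k ≠ 0) (hd : (derivative F.det).eval x₀ ≠ 0) :
    (w ⬝ᵥ ((F.map (Polynomial.eval x₀)).adjugate *ᵥ w)) *
        (k ⬝ᵥ (F.map (fun p => (derivative p).eval x₀) *ᵥ k)) =
      (derivative F.det).eval x₀ * (w ⬝ᵥ k) ^ 2 := by
  -- names for the evaluated objects
  set A : Matrix n n ℝ := F.map (Polynomial.eval x₀) with hA
  set B : Matrix n n ℝ := A.adjugate with hB
  set D : Matrix n n ℝ := F.map (fun p => (derivative p).eval x₀) with hDdef
  set c : ℝ := (derivative F.det).eval x₀ with hc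
  have hD : D = (F.map (⇑derivative)).map (Polynomial.eval x₀) := by
    rw [hDdef, Matrix.map_map]
    rfl
  -- symmetry of `A`, `B`, `D`
  have hAs : A.IsSymm := by
    unfold Matrix.IsSymm
    rw [hA, ← Matrix.transpose_map, hF.eq]
  have hBs : B.IsSymm := by
    unfold Matrix.IsSymm
    rw [hB, Matrix.adjugate_transpose, hAs.eq]
  have hDs : D.IsSymm := by
    unfold Matrix.IsSymm
    rw [hD, ← Matrix.transpose_map, ← Matrix.transpose_map, hF.eq]
  -- `det A = 0`, so `A B = 0`
  have hdetA : A.det = 0 := Matrix.exists_mulVec_eq_zero_iff.mp ⟨k, hk0, hk⟩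
  have hAB : A * B = 0 := by rw [hB, Matrix.mul_adjugate, hdetA, zero_smul]
  -- the differentiated identity `F′ adj F + F (adj F)′ = f′ • 1`, evaluated: `D B + A B₁ = c • 1`
  have hpoly : F.map (⇑derivative) * F.adjugate + F * F.adjugate.map (⇑derivative) =
      derivative F.det • (1 : Matrix n n ℝ[X]) := by
    rw [← map_derivative_mul, Matrix.mul_adjugate, map_derivative_smul_one]
  have heval : D * B + A * (F.adjugate.map (⇑derivative)).map (Polynomial.eval x₀) =
      c • (1 : Matrix n n ℝ) := by
    have h := congrArg (fun M : Matrix n n ℝ[X] => M.map (Polynomial.eval x₀)) hpoly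
    rw [← Polynomial.coe_evalRingHom,
      Matrix.map_add _ (fun a b => map_add (Polynomial.evalRingHom x₀) a b), Matrix.map_mul,
      Matrix.map_mul,
      Matrix.map_smul' _ _ _ (fun a b => map_mul (Polynomial.evalRingHom x₀) a b),
      Matrix.map_one _ (map_zero _) (map_one _)] at h
    rw [hD, hB, hA, hc, ← adjugate_map_eval, ← Polynomial.coe_evalRingHom]
    exact h
  -- `B D k = c k`
  have hBDk : B *ᵥ (D *ᵥ k) = c • k := by
    have h := congrArg Matrix.transpose heval
    rw [Matrix.transpose_add, Matrix.transpose_mul, Matrix.transpose_mul, Matrix.transpose_smul,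
      Matrix.transpose_one, hBs.eq, hDs.eq, hAs.eq] at h
    have h2 := congrArg (fun M : Matrix n n ℝ => M *ᵥ k) h
    rw [Matrix.add_mulVec, ← Matrix.mulVec_mulVec, ← Matrix.mulVec_mulVec, hk, Matrix.mulVec_zero,
      add_zero, Matrix.smul_mulVec, Matrix.one_mulVec] at h2
    exact h2
  -- `adj A ≠ 0` (Jacobi: `c = tr (B D)`), hence `ker A = ℝ k` and `B w = β k`
  have hBne : B ≠ 0 := by
    intro hB0
    apply hd
    rw [hc, eval_derivative_det, ← hA, ← hB, hB0, Matrix.zero_mul, Matrix.trace_zero]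
  have hBw : A *ᵥ (B *ᵥ w) = 0 := by rw [Matrix.mulVec_mulVec, hAB, Matrix.zero_mulVec]
  obtain ⟨β, hβ⟩ := exists_eq_smul_of_kernel A (B *ᵥ w) k hBw hk hk0 hBne
  -- `β (kᵀ D k) = c (w·k)`
  have hβ' : β * (k ⬝ᵥ (D *ᵥ k)) = c * (w ⬝ᵥ k) := by
    have h := congrArg (fun v : n → ℝ => v ⬝ᵥ w) hBDk
    rw [mulVec_dotProduct_of_isSymm_real hBs, hβ, dotProduct_smul, smul_dotProduct, smul_eq_mul,
      smul_eq_mul, mulVec_dotProduct_of_isSymm_real hDs, dotProduct_comm k w] at h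
    exact h
  -- assemble: `wᵀ B w = β (w·k)`
  rw [hβ, dotProduct_smul, smul_eq_mul]
  calc β * (w ⬝ᵥ k) * (k ⬝ᵥ (D *ᵥ k)) = (β * (k ⬝ᵥ (D *ᵥ k))) * (w ⬝ᵥ k) := by ring
    _ = c * (w ⬝ᵥ k) * (w ⬝ᵥ k) := by rw [hβ']
    _ = c * (w ⬝ᵥ k) ^ 2 := by ring

/-! ## §3 The residual at a simple root, and the forced zero -/

/-- Evaluation of the compression polynomial `a = wᵀ adj(F) w` at a point. [folklore] -/
theorem eval_compDet {n : Type*} [Fintype n] [DecidableEq n] (F : Matrix n n ℝ[X]) (w : n → ℝ)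
    (x₀ : ℝ) :
    ((fun i => C (w i)) ⬝ᵥ (F.adjugate *ᵥ fun i => C (w i))).eval x₀ =
      w ⬝ᵥ ((F.map (Polynomial.eval x₀)).adjugate *ᵥ w) := by
  have hw : ((Polynomial.eval x₀) ∘ fun i => C (w i)) = w := by
    funext i
    simp
  have hv : ((Polynomial.eval x₀) ∘ (F.adjugate *ᵥ fun i => C (w i))) =
      (F.map (Polynomial.eval x₀)).adjugate *ᵥ w := by
    funext i
    rw [Function.comp_apply, ← Polynomial.coe_evalRingHom, RingHom.map_mulVec,
      Polynomial.coe_evalRingHom, hw, adjugate_map_eval]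
  have h := RingHom.map_dotProduct (Polynomial.evalRingHom x₀) (fun i => C (w i))
    (F.adjugate *ᵥ fun i => C (w i))
  rw [Polynomial.coe_evalRingHom] at h
  rw [h, hw, hv]

/-- **The residual at a root of `det F`.**  With `f = det F`, `a = wᵀ adj(F) w` and
`P = X·(f′a − fa′) − e·fa`: if `f(x₀) = 0` then `P(x₀) = x₀ · f′(x₀) · a(x₀)`. [folklore] -/
theorem eval_residual_of_root {n : Type*} [Fintype n] [DecidableEq n] (F : Matrix n n ℝ[X])
    (hF : F.IsSymm) (w : n → ℝ) (e x₀ : ℝ) (hf : F.det.eval x₀ = 0) :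
    ((F.adjugate *ᵥ fun i => C (w i)) ⬝ᵥ
        (((X : ℝ[X]) • F.map (⇑derivative) - C e • F) *ᵥ (F.adjugate *ᵥ fun i => C (w i)))).eval x₀ =
      x₀ * (derivative F.det).eval x₀ * (w ⬝ᵥ ((F.map (Polynomial.eval x₀)).adjugate *ᵥ w)) := by
  rw [residual_eq F hF _ (fun i => derivative_C) e]
  simp only [eval_sub, eval_mul, eval_X, eval_C, hf, zero_mul, sub_zero, mul_zero]
  rw [eval_compDet, mul_assoc]

/-- At a kernel vector the determinant vanishes: `F(x₀) k = 0`, `k ≠ 0 ⇒ (det F)(x₀) = 0`.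
[folklore] -/
theorem eval_det_eq_zero_of_kernel {n : Type*} [Fintype n] [DecidableEq n] (F : Matrix n n ℝ[X])
    (x₀ : ℝ) (k : n → ℝ) (hk : (F.map (Polynomial.eval x₀)) *ᵥ k = 0) (hk0 : k ≠ 0) :
    F.det.eval x₀ = 0 := by
  rw [← Polynomial.coe_evalRingHom, RingHom.map_det, RingHom.mapMatrix_apply,
    Polynomial.coe_evalRingHom]
  exact Matrix.exists_mulVec_eq_zero_iff.mp ⟨k, hk0, hk⟩

/-- **Forced zeros (instrument lemma K3)** — the line's stub `stub_forcedZeros`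
(`Cruxes/MatrixDescartes/Lines/rolle_schur_residual.lean`) with the line's vocabulary (`pencil`,
`shifted`, `adjVec`, `residual`) UNFOLDED, so that the line closes it by `exact forcedZeros`.
Between two SIMPLE positive roots `x₁ < x₂` of `det F` (kernel vectors `k₁, k₂`) whose crossings
have opposite Hellmann–Feynman signs `(k₁ᵀF′(x₁)k₁)(k₂ᵀF′(x₂)k₂) < 0`, the residual `P_{w,e}`
vanishes somewhere in `(x₁, x₂)`, for every real shift `e` and every `w` with `w·k₁ ≠ 0 ≠ w·k₂`.
Proof: `P(xᵢ) = xᵢ f′(xᵢ) a(xᵢ)` (`eval_residual_of_root`) and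
`a(xᵢ)·kᵢᵀF′(xᵢ)kᵢ = f′(xᵢ)(w·kᵢ)²` (`compDet_mul_quadForm_eq`), so
`P(x₁)P(x₂)·(k₁ᵀF′k₁)(k₂ᵀF′k₂) = x₁x₂ f′(x₁)²f′(x₂)²(w·k₁)²(w·k₂)² > 0`, whence `P(x₁)P(x₂) < 0`
and the intermediate value theorem applies.  (The hypothesis that `det F` has no root in
`(x₁, x₂)` is carried but not used.) [folklore] -/
theorem forcedZeros (m K : ℕ) (d : Fin K → ℕ) (S : Fin K → Matrix (Fin m) (Fin m) ℝ)
    (w : Fin m → ℝ) (e x₁ x₂ : ℝ) (k₁ k₂ : Fin m → ℝ) (hS : ∀ l, (S l).IsSymm) (hx₁ : 0 < x₁)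
    (hx₁₂ : x₁ < x₂)
    (hk₁ : ((∑ l, ((X : ℝ[X]) ^ d l) • (S l).map C).map (Polynomial.eval x₁)).mulVec k₁ = 0)
    (hk₁0 : k₁ ≠ 0)
    (hk₂ : ((∑ l, ((X : ℝ[X]) ^ d l) • (S l).map C).map (Polynomial.eval x₂)).mulVec k₂ = 0)
    (hk₂0 : k₂ ≠ 0)
    (_hgap : ∀ x, x₁ < x → x < x₂ → (∑ l, ((X : ℝ[X]) ^ d l) • (S l).map C).det.eval x ≠ 0)
    (hd₁ : (Polynomial.derivative (∑ l, ((X : ℝ[X]) ^ d l) • (S l).map C).det).eval x₁ ≠ 0)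
    (hd₂ : (Polynomial.derivative (∑ l, ((X : ℝ[X]) ^ d l) • (S l).map C).det).eval x₂ ≠ 0)
    (hw₁ : w ⬝ᵥ k₁ ≠ 0) (hw₂ : w ⬝ᵥ k₂ ≠ 0)
    (hrev : (k₁ ⬝ᵥ ((∑ l, ((X : ℝ[X]) ^ d l) • (S l).map C).map
              (fun p => (Polynomial.derivative p).eval x₁)).mulVec k₁) *
          (k₂ ⬝ᵥ ((∑ l, ((X : ℝ[X]) ^ d l) • (S l).map C).map
              (fun p => (Polynomial.derivative p).eval x₂)).mulVec k₂) < 0) :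
    ∃ x, x₁ < x ∧ x < x₂ ∧
      ((∑ l, ((X : ℝ[X]) ^ d l) • (S l).map C).adjugate.mulVec (fun i => C (w i)) ⬝ᵥ
          (∑ l, (C ((d l : ℝ) - e) * (X : ℝ[X]) ^ d l) • (S l).map C).mulVec
            ((∑ l, ((X : ℝ[X]) ^ d l) • (S l).map C).adjugate.mulVec (fun i => C (w i)))).eval
        x = 0 := by
  set F : Matrix (Fin m) (Fin m) ℝ[X] := ∑ l, ((X : ℝ[X]) ^ d l) • (S l).map C with hFdef
  have hFs : F.IsSymm := pencil_isSymm d S hS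
  rw [shifted_eq d S e]
  -- the residual polynomial and its values at the two roots
  set P : ℝ[X] := (F.adjugate *ᵥ fun i => C (w i)) ⬝ᵥ
      (((X : ℝ[X]) • F.map (⇑derivative) - C e • F) *ᵥ (F.adjugate *ᵥ fun i => C (w i))) with hP
  have hf₁ : F.det.eval x₁ = 0 := eval_det_eq_zero_of_kernel F x₁ k₁ hk₁ hk₁0
  have hf₂ : F.det.eval x₂ = 0 := eval_det_eq_zero_of_kernel F x₂ k₂ hk₂ hk₂0
  have hP₁ : P.eval x₁ = x₁ * (derivative F.det).eval x₁ *
      (w ⬝ᵥ ((F.map (Polynomial.eval x₁)).adjugate *ᵥ w)) :=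
    eval_residual_of_root F hFs w e x₁ hf₁
  have hP₂ : P.eval x₂ = x₂ * (derivative F.det).eval x₂ *
      (w ⬝ᵥ ((F.map (Polynomial.eval x₂)).adjugate *ᵥ w)) :=
    eval_residual_of_root F hFs w e x₂ hf₂
  -- Hellmann–Feynman at the two roots
  have hHF₁ := compDet_mul_quadForm_eq F hFs x₁ k₁ w hk₁ hk₁0 hd₁
  have hHF₂ := compDet_mul_quadForm_eq F hFs x₂ k₂ w hk₂ hk₂0 hd₂
  -- sign of `P(x₁) P(x₂)`
  have hx₂ : 0 < x₂ := hx₁.trans hx₁₂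
  have hprod : (P.eval x₁ * P.eval x₂) *
      ((k₁ ⬝ᵥ (F.map (fun p => (derivative p).eval x₁) *ᵥ k₁)) *
        (k₂ ⬝ᵥ (F.map (fun p => (derivative p).eval x₂) *ᵥ k₂))) =
      x₁ * x₂ * ((derivative F.det).eval x₁ * (w ⬝ᵥ k₁)) ^ 2 *
        ((derivative F.det).eval x₂ * (w ⬝ᵥ k₂)) ^ 2 := by
    rw [hP₁, hP₂]
    calc x₁ * (derivative F.det).eval x₁ * (w ⬝ᵥ ((F.map (Polynomial.eval x₁)).adjugate *ᵥ w)) *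
          (x₂ * (derivative F.det).eval x₂ * (w ⬝ᵥ ((F.map (Polynomial.eval x₂)).adjugate *ᵥ w))) *
          ((k₁ ⬝ᵥ (F.map (fun p => (derivative p).eval x₁) *ᵥ k₁)) *
            (k₂ ⬝ᵥ (F.map (fun p => (derivative p).eval x₂) *ᵥ k₂)))
        = x₁ * x₂ * (derivative F.det).eval x₁ * (derivative F.det).eval x₂ *
          ((w ⬝ᵥ ((F.map (Polynomial.eval x₁)).adjugate *ᵥ w)) *
            (k₁ ⬝ᵥ (F.map (fun p => (derivative p).eval x₁) *ᵥ k₁))) *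
          ((w ⬝ᵥ ((F.map (Polynomial.eval x₂)).adjugate *ᵥ w)) *
            (k₂ ⬝ᵥ (F.map (fun p => (derivative p).eval x₂) *ᵥ k₂))) := by ring
      _ = x₁ * x₂ * ((derivative F.det).eval x₁ * (w ⬝ᵥ k₁)) ^ 2 *
          ((derivative F.det).eval x₂ * (w ⬝ᵥ k₂)) ^ 2 := by
        rw [hHF₁, hHF₂]
        ring
  have hpos : 0 < x₁ * x₂ * ((derivative F.det).eval x₁ * (w ⬝ᵥ k₁)) ^ 2 *
      ((derivative F.det).eval x₂ * (w ⬝ᵥ k₂)) ^ 2 := by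
    have h1 : (derivative F.det).eval x₁ * (w ⬝ᵥ k₁) ≠ 0 := mul_ne_zero hd₁ hw₁
    have h2 : (derivative F.det).eval x₂ * (w ⬝ᵥ k₂) ≠ 0 := mul_ne_zero hd₂ hw₂
    positivity
  have hneg : P.eval x₁ * P.eval x₂ < 0 := by
    by_contra h
    push Not at h
    have h' := mul_nonpos_iff.mpr (Or.inl ⟨h, hrev.le⟩)
    rw [hprod] at h'
    exact absurd h' (not_le.mpr hpos)
  -- intermediate value theorem
  have hcont : ContinuousOn (fun t => P.eval t) (Set.Icc x₁ x₂) := P.continuous.continuousOn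
  rcases mul_neg_iff.mp hneg with ⟨h1, h2⟩ | ⟨h1, h2⟩
  · obtain ⟨x, hx, hx0⟩ := intermediate_value_Ioo' hx₁₂.le hcont ⟨h2, h1⟩
    exact ⟨x, hx.1, hx.2, hx0⟩
  · obtain ⟨x, hx, hx0⟩ := intermediate_value_Ioo hx₁₂.le hcont ⟨h1, h2⟩
    exact ⟨x, hx.1, hx.2, hx0⟩

end RolleSchur

end Summit.ValiantsHypothesis.ValiantsHypothesis.Theorems.LacunarySymmetroidMatrixDescartes
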